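import Summits.CriticalPhenomena.PercolationContinuityZ3.Theorems.PercBurnResprinkleUniformDiminishmentSurgery

/-!
# Uniform diminishment on `ℤ³` (4/8): the linking sets and the axis selection

Helper file for item `stmt-CriticalPhenomena-7206` (`PercBurnResprinkle.UniformDiminishment`, the quenched,
uniform Aizenman–Grimmett diminishment on `ℤ³`), landed with `--supports stmt-CriticalPhenomena-7206`.
The proof runs the in-tree Aizenman–Grimmett engine (`Literature.Probability.Percolation.AGLine`, after
Martineau–Severo 2019 §6) for the two-parameter model "edges open with probability `p`, points of the
thinned deleted set restored with probability `s`"; no definitions are introduced — the available-edge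
map `av` and the exit event `A` enter through characterising hypotheses (`hav`, `hA`).

Contents: inside the box `Q = d + box ρ`, for an entrance point `a` and a target `t`, the explicit
linking sets "face ∪ column ∪ ray" on two opposite sides of an axis (`exists_linking_sets`: disjoint,
`a ↝ d` and `d ↝ t` by straight moves, entrance side inside `o + box r`), under five compatibility
conditions; and the choice of the axis and of its orientation for distinct `a, t ≠ d` (`exists_axis`).
-/

namespace Summit.CriticalPhenomena.PercolationContinuityZ3.Theorems

open Literature.Probability.Percolation Literature.Probability.LatticeModels

namespace UnifDim

/-! ### Geometry of the surgery: the two linking sets inside the box `d + box ρ`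

Given the entrance point `a` and the target `t` in `Q = d + box ρ`, an axis `i` and the two opposite
face levels `s = dᵢ ± ρ` (target side), `s' = dᵢ ∓ ρ` (entrance side), the target-side set is
"face at level `s` ∪ column from `t` to that face ∪ ray from `d` to that face" and the entrance-side
set is "face at level `s'` ∪ column from `a` ∪ ray from `d`", cut down to `o + box r`; both without
`d`. Under the five compatibility conditions below they are disjoint, and straight moves link
`a ↝ d` and `d ↝ t` inside them. -/

section Geometry

/-- A coordinate column `{v | v ≡ c off i, vᵢ ∈ [[p, q]]}` is boxy. -/
theorem boxy_col (c : Site 3) (i : Fin 3) (p q : ℤ) :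
    ∀ u ∈ {v : Site 3 | (∀ j, j ≠ i → v j = c j) ∧ v i ∈ Set.uIcc p q},
      ∀ w ∈ {v : Site 3 | (∀ j, j ≠ i → v j = c j) ∧ v i ∈ Set.uIcc p q}, ∀ v : Site 3,
      (∀ i, v i ∈ Set.uIcc (u i) (w i)) →
        v ∈ {v : Site 3 | (∀ j, j ≠ i → v j = c j) ∧ v i ∈ Set.uIcc p q} := by
  intro u hu w hw v hv
  simp only [Set.mem_setOf_eq] at hu hw ⊢
  refine ⟨fun j hj => ?_, ?_⟩
  · have h := hv j
    rw [hu.1 j hj, hw.1 j hj, Set.uIcc_self, Set.mem_singleton_iff] at h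
    exact h
  · have h := hv i
    have h1 := hu.2; have h2 := hw.2
    rw [Set.mem_uIcc] at h h1 h2 ⊢
    omega

/-- Updating one coordinate of a point of a column keeps it in the column when the new value is
admissible. -/
theorem update_mem_col {c v : Site 3} {i : Fin 3} {p q x : ℤ} (hv : ∀ j, j ≠ i → v j = c j)
    (hx : x ∈ Set.uIcc p q) :
    Function.update v i x ∈ {v : Site 3 | (∀ j, j ≠ i → v j = c j) ∧ v i ∈ Set.uIcc p q} := by
  refine ⟨fun j hj => ?_, ?_⟩
  · rw [Function.update_of_ne hj]; exact hv j hj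
  · rw [Function.update_self]; exact hx

/-- Updating the `i`-th coordinate inside a translated box. -/
theorem update_sub_mem_box {c v : Site 3} {i : Fin 3} {n : ℕ} {x : ℤ} (hv : v - c ∈ box 3 n)
    (hx : -(n : ℤ) ≤ x - c i ∧ x - c i ≤ n) : Function.update v i x - c ∈ box 3 n := by
  rw [sub_mem_box_iff] at hv ⊢
  intro j
  by_cases hj : j = i
  · subst hj; rw [Function.update_self]; exact hx
  · rw [Function.update_of_ne hj]; exact hv j

/-- **The linking sets.** See the section docstring; the conditions are:
`C1`: if `t` lies on the axis line through `d` then strictly on the target side; `C2`: if `a` lies on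
it then strictly on the entrance side; `C3`: `a` is not on the target face; `C4`: `t` is not on the
entrance face; `C5`: if `a, t` share a column then `t` is on the target side of `a`; `hP`: the
entrance face level lies within `o + box r` (in coordinate `i`). -/
theorem exists_linking_sets {d o a t : Site 3} {ρ r : ℕ} {i : Fin 3} {s s' : ℤ}
    (hs : (s = d i + ρ ∧ s' = d i - ρ) ∨ (s = d i - ρ ∧ s' = d i + ρ)) (hρ : 1 ≤ ρ)
    (haQ : a - d ∈ box 3 ρ) (htQ : t - d ∈ box 3 ρ) (had : a ≠ d) (htd : t ≠ d)
    (haN : a - o ∈ box 3 r) (hdN : d - o ∈ box 3 r) (hP : -(r : ℤ) ≤ s' - o i ∧ s' - o i ≤ r)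
    (C1 : (∀ j, j ≠ i → t j = d j) → (d i < t i ∧ d i < s) ∨ (t i < d i ∧ s < d i))
    (C2 : (∀ j, j ≠ i → a j = d j) → (a i < d i ∧ d i < s) ∨ (d i < a i ∧ s < d i))
    (C3 : a i ≠ s) (C4 : t i ≠ s')
    (C5 : (∀ j, j ≠ i → a j = t j) → (a i < t i ∧ d i < s) ∨ (t i < a i ∧ s < d i)) :
    ∃ Xa Xb : Set (Site 3), a ∈ Xa ∧ t ∈ Xb ∧ d ∉ Xa ∧ d ∉ Xb ∧ Disjoint Xa Xb ∧
      (∀ v ∈ Xa, v - d ∈ box 3 ρ) ∧ (∀ v ∈ Xb, v - d ∈ box 3 ρ) ∧ (∀ v ∈ Xa, v - o ∈ box 3 r) ∧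
      (siteOpenGraph (zdGraph 3) (insert d Xa)).Reachable a d ∧
      (siteOpenGraph (zdGraph 3) (insert d Xb)).Reachable d t := by
  classical
  -- coordinate bounds used throughout
  have haQi := (sub_mem_box_iff.1 haQ) i
  have htQi := (sub_mem_box_iff.1 htQ) i
  have hdNi := (sub_mem_box_iff.1 hdN) i
  -- the pieces
  set Q : Set (Site 3) := {v | v - d ∈ box 3 ρ} with hQ
  set N : Set (Site 3) := {v | v - o ∈ box 3 r} with hN
  set Fb : Set (Site 3) := Q ∩ {v | v i = s} with hFb
  set Colt : Set (Site 3) := {v | (∀ j, j ≠ i → v j = t j) ∧ v i ∈ Set.uIcc (t i) s} with hColt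
  set Rayb : Set (Site 3) := {v | (∀ j, j ≠ i → v j = d j) ∧ v i ∈ Set.uIcc (d i) s} with hRayb
  set Fa : Set (Site 3) := Q ∩ {v | v i = s'} with hFa
  set Cola : Set (Site 3) := {v | (∀ j, j ≠ i → v j = a j) ∧ v i ∈ Set.uIcc (a i) s'} with hCola
  set Raya : Set (Site 3) := {v | (∀ j, j ≠ i → v j = d j) ∧ v i ∈ Set.uIcc (d i) s'} with hRaya
  set Xb : Set (Site 3) := (Fb ∪ Colt ∪ Rayb) \ {d} with hXb
  set Xa : Set (Site 3) := ((Fa ∪ Cola ∪ Raya) ∩ N) \ {d} with hXa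
  -- columns and rays stay in `Q`
  have hColtQ : Colt ⊆ Q := by
    rintro v ⟨hv, hvi⟩
    rw [hQ, Set.mem_setOf_eq, sub_mem_box_iff]
    intro j
    by_cases hj : j = i
    · subst hj; rw [Set.mem_uIcc] at hvi; omega
    · rw [hv j hj]; exact (sub_mem_box_iff.1 htQ) j
  have hRaybQ : Rayb ⊆ Q := by
    rintro v ⟨hv, hvi⟩
    rw [hQ, Set.mem_setOf_eq, sub_mem_box_iff]
    intro j
    by_cases hj : j = i
    · subst hj; rw [Set.mem_uIcc] at hvi; omega
    · rw [hv j hj]; simp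
  have hColaQ : Cola ⊆ Q := by
    rintro v ⟨hv, hvi⟩
    rw [hQ, Set.mem_setOf_eq, sub_mem_box_iff]
    intro j
    by_cases hj : j = i
    · subst hj; rw [Set.mem_uIcc] at hvi; omega
    · rw [hv j hj]; exact (sub_mem_box_iff.1 haQ) j
  have hRayaQ : Raya ⊆ Q := by
    rintro v ⟨hv, hvi⟩
    rw [hQ, Set.mem_setOf_eq, sub_mem_box_iff]
    intro j
    by_cases hj : j = i
    · subst hj; rw [Set.mem_uIcc] at hvi; omega
    · rw [hv j hj]; simp
  have hXbQ : ∀ v ∈ Xb, v - d ∈ box 3 ρ := by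
    rintro v ⟨(hv | hv) | hv, -⟩
    · exact hv.1
    · exact hColtQ hv
    · exact hRaybQ hv
  have hXaQ : ∀ v ∈ Xa, v - d ∈ box 3 ρ := by
    rintro v ⟨⟨(hv | hv) | hv, -⟩, -⟩
    · exact hv.1
    · exact hColaQ hv
    · exact hRayaQ hv
  refine ⟨Xa, Xb, ?_, ?_, fun h => h.2 rfl, fun h => h.2 rfl, ?_, hXaQ, hXbQ, fun v hv => hv.1.2, ?_, ?_⟩
  · -- `a ∈ Xa`
    exact ⟨⟨Or.inl (Or.inr ⟨fun j _ => rfl, Set.left_mem_uIcc⟩), haN⟩, had⟩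
  · -- `t ∈ Xb`
    exact ⟨Or.inl (Or.inr ⟨fun j _ => rfl, Set.left_mem_uIcc⟩), htd⟩
  · -- disjointness: nine cases of linear arithmetic
    rw [Set.disjoint_left]
    rintro v ⟨⟨hva, -⟩, hvd⟩ ⟨hvb, -⟩
    have hvne : ¬ ((∀ j, j ≠ i → v j = d j) ∧ v i = d i) := by
      rintro ⟨h1, h2⟩
      refine hvd (funext fun j => ?_)
      by_cases hj : j = i
      · subst hj; exact h2
      · exact h1 j hj
    rcases hva with (⟨hvQ, hvi⟩ | ⟨hvc, hvi⟩) | ⟨hvc, hvi⟩ <;>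
      rcases hvb with (⟨hvQ', hvi'⟩ | ⟨hvc', hvi'⟩) | ⟨hvc', hvi'⟩
    · -- Fa ∩ Fb
      simp only [Set.mem_setOf_eq] at hvi hvi'
      omega
    · -- Fa ∩ Colt
      simp only [Set.mem_setOf_eq, Set.mem_uIcc] at hvi hvi'
      omega
    · -- Fa ∩ Rayb
      simp only [Set.mem_setOf_eq, Set.mem_uIcc] at hvi hvi'
      omega
    · -- Cola ∩ Fb
      simp only [Set.mem_setOf_eq, Set.mem_uIcc] at hvi hvi'
      omega
    · -- Cola ∩ Colt
      have h5 := C5 fun j hj => (hvc j hj).symm.trans (hvc' j hj)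
      simp only [Set.mem_uIcc] at hvi hvi'
      omega
    · -- Cola ∩ Rayb
      have h2 := C2 fun j hj => (hvc j hj).symm.trans (hvc' j hj)
      simp only [Set.mem_uIcc] at hvi hvi'
      omega
    · -- Raya ∩ Fb
      simp only [Set.mem_setOf_eq, Set.mem_uIcc] at hvi hvi'
      omega
    · -- Raya ∩ Colt
      have h1 := C1 fun j hj => (hvc' j hj).symm.trans (hvc j hj)
      simp only [Set.mem_uIcc] at hvi hvi'
      omega
    · -- Raya ∩ Rayb
      simp only [Set.mem_uIcc] at hvi hvi'
      have : v i = d i := by omega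
      exact absurd ⟨hvc, this⟩ hvne
  · -- `a ↝ d` inside `insert d Xa`
    have hsub : (Fa ∪ Cola ∪ Raya) ∩ N ⊆ insert d Xa := by
      intro v hv
      by_cases hvd : v = d
      · exact Or.inl hvd
      · exact Or.inr ⟨hv, hvd⟩
    -- corner points
    set a₁ : Site 3 := Function.update a i s' with ha₁
    set φ : Site 3 := Function.update d i s' with hφ
    have hs'Q : -(ρ : ℤ) ≤ s' - d i ∧ s' - d i ≤ ρ := by omega
    have haNi := (sub_mem_box_iff.1 haN) i
    have ha₁Cola : a₁ ∈ Cola := update_mem_col (fun j _ => rfl) Set.right_mem_uIcc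
    have ha₁N : a₁ ∈ N := update_sub_mem_box haN hP
    have ha₁Fa : a₁ ∈ Fa := ⟨update_sub_mem_box haQ hs'Q, by simp [ha₁]⟩
    have hφFa : φ ∈ Fa := ⟨update_sub_mem_box (by simp) hs'Q, by simp [hφ]⟩
    have hφN : φ ∈ N := update_sub_mem_box hdN hP
    have hφRaya : φ ∈ Raya := update_mem_col (fun j _ => rfl) Set.right_mem_uIcc
    have hdRaya : d ∈ Raya := ⟨fun j _ => rfl, Set.left_mem_uIcc⟩
    have haCola : a ∈ Cola := ⟨fun j _ => rfl, Set.left_mem_uIcc⟩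
    -- the three straight moves
    have step₁ : (siteOpenGraph (zdGraph 3) (Cola ∩ N)).Reachable a a₁ :=
      reachable_siteOpenGraph_of_boxy (boxy_inter (boxy_col a i (a i) s') (boxy_box o r))
        ⟨haCola, haN⟩ ⟨ha₁Cola, ha₁N⟩
    have step₂ : (siteOpenGraph (zdGraph 3) (Fa ∩ N)).Reachable a₁ φ :=
      reachable_siteOpenGraph_of_boxy
        (boxy_inter (boxy_inter (boxy_box d ρ) (boxy_hyperplane i s')) (boxy_box o r))
        ⟨ha₁Fa, ha₁N⟩ ⟨hφFa, hφN⟩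
    have step₃ : (siteOpenGraph (zdGraph 3) (Raya ∩ N)).Reachable φ d :=
      reachable_siteOpenGraph_of_boxy (boxy_inter (boxy_col d i (d i) s') (boxy_box o r))
        ⟨hφRaya, hφN⟩ ⟨hdRaya, hdN⟩
    refine (reachable_siteOpenGraph_mono ?_ step₁).trans
      ((reachable_siteOpenGraph_mono ?_ step₂).trans (reachable_siteOpenGraph_mono ?_ step₃))
    · exact fun v hv => hsub ⟨Or.inl (Or.inr hv.1), hv.2⟩
    · exact fun v hv => hsub ⟨Or.inl (Or.inl hv.1), hv.2⟩
    · exact fun v hv => hsub ⟨Or.inr hv.1, hv.2⟩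
  · -- `d ↝ t` inside `insert d Xb`
    have hsub : Fb ∪ Colt ∪ Rayb ⊆ insert d Xb := by
      intro v hv
      by_cases hvd : v = d
      · exact Or.inl hvd
      · exact Or.inr ⟨hv, hvd⟩
    set t₁ : Site 3 := Function.update t i s with ht₁
    set ψ : Site 3 := Function.update d i s with hψ
    have hsQ : -(ρ : ℤ) ≤ s - d i ∧ s - d i ≤ ρ := by omega
    have ht₁Colt : t₁ ∈ Colt := update_mem_col (fun j _ => rfl) Set.right_mem_uIcc
    have ht₁Fb : t₁ ∈ Fb := ⟨update_sub_mem_box htQ hsQ, by simp [ht₁]⟩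
    have hψFb : ψ ∈ Fb := ⟨update_sub_mem_box (by simp) hsQ, by simp [hψ]⟩
    have hψRayb : ψ ∈ Rayb := update_mem_col (fun j _ => rfl) Set.right_mem_uIcc
    have hdRayb : d ∈ Rayb := ⟨fun j _ => rfl, Set.left_mem_uIcc⟩
    have htColt : t ∈ Colt := ⟨fun j _ => rfl, Set.left_mem_uIcc⟩
    have step₁ : (siteOpenGraph (zdGraph 3) Rayb).Reachable d ψ :=
      reachable_siteOpenGraph_of_boxy (boxy_col d i (d i) s) hdRayb hψRayb
    have step₂ : (siteOpenGraph (zdGraph 3) Fb).Reachable ψ t₁ :=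
      reachable_siteOpenGraph_of_boxy (boxy_inter (boxy_box d ρ) (boxy_hyperplane i s)) hψFb ht₁Fb
    have step₃ : (siteOpenGraph (zdGraph 3) Colt).Reachable t₁ t :=
      reachable_siteOpenGraph_of_boxy (boxy_col t i (t i) s) ht₁Colt htColt
    refine (reachable_siteOpenGraph_mono ?_ step₁).trans
      ((reachable_siteOpenGraph_mono ?_ step₂).trans (reachable_siteOpenGraph_mono ?_ step₃))
    · exact fun v hv => hsub (Or.inr hv)
    · exact fun v hv => hsub (Or.inl (Or.inl hv))
    · exact fun v hv => hsub (Or.inl (Or.inr hv))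


/-- Two points agreeing off the coordinate `i` and distinct differ at `i`. -/
theorem apply_ne_of_ne {u w : Site 3} {i : Fin 3} (h : u ≠ w) (hoff : ∀ j, j ≠ i → u j = w j) :
    u i ≠ w i := by
  intro hi
  refine h (funext fun j => ?_)
  by_cases hj : j = i
  · subst hj; exact hi
  · exact hoff j hj

/-- The axis selection at a coordinate where `a` and `t` differ: orient the axis from `a` towards `t`;
the line conditions `C1`, `C2` are supplied in implication form. -/
theorem exists_levels_of_apply_ne {a t d : Site 3} {ρ : ℕ} (hρ : 1 ≤ ρ) (haQ : a - d ∈ box 3 ρ)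
    (htQ : t - d ∈ box 3 ρ) {i : Fin 3} (hi : a i ≠ t i)
    (H1 : (∀ j, j ≠ i → t j = d j) → (a i < t i → d i < t i) ∧ (t i < a i → t i < d i))
    (H2 : (∀ j, j ≠ i → a j = d j) → (a i < t i → a i < d i) ∧ (t i < a i → d i < a i)) :
    ∃ s s' : ℤ, ((s = d i + ρ ∧ s' = d i - ρ) ∨ (s = d i - ρ ∧ s' = d i + ρ)) ∧
      ((∀ j, j ≠ i → t j = d j) → (d i < t i ∧ d i < s) ∨ (t i < d i ∧ s < d i)) ∧
      ((∀ j, j ≠ i → a j = d j) → (a i < d i ∧ d i < s) ∨ (d i < a i ∧ s < d i)) ∧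
      a i ≠ s ∧ t i ≠ s' ∧
      ((∀ j, j ≠ i → a j = t j) → (a i < t i ∧ d i < s) ∨ (t i < a i ∧ s < d i)) := by
  have haQi := (sub_mem_box_iff.1 haQ) i
  have htQi := (sub_mem_box_iff.1 htQ) i
  rcases lt_or_gt_of_ne hi with hlt | hlt
  · refine ⟨d i + ρ, d i - ρ, Or.inl ⟨rfl, rfl⟩, fun h => ?_, fun h => ?_, by omega, by omega,
      fun _ => Or.inl ⟨hlt, by omega⟩⟩
    · exact Or.inl ⟨(H1 h).1 hlt, by omega⟩
    · exact Or.inl ⟨(H2 h).1 hlt, by omega⟩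
  · refine ⟨d i - ρ, d i + ρ, Or.inr ⟨rfl, rfl⟩, fun h => ?_, fun h => ?_, by omega, by omega,
      fun _ => Or.inr ⟨hlt, by omega⟩⟩
    · exact Or.inr ⟨(H1 h).2 hlt, by omega⟩
    · exact Or.inr ⟨(H2 h).2 hlt, by omega⟩

/-- **Axis selection** (case `Q ⊆ o + box r` of the surgery). For distinct `a, t ≠ d` in `d + box ρ`
there are an axis `i` and face levels `s, s'` satisfying the conditions of `exists_linking_sets`. -/
theorem exists_axis {a t d : Site 3} {ρ : ℕ} (hρ : 1 ≤ ρ) (hat : a ≠ t) (had : a ≠ d) (htd : t ≠ d)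
    (haQ : a - d ∈ box 3 ρ) (htQ : t - d ∈ box 3 ρ) :
    ∃ (i : Fin 3) (s s' : ℤ), ((s = d i + ρ ∧ s' = d i - ρ) ∨ (s = d i - ρ ∧ s' = d i + ρ)) ∧
      ((∀ j, j ≠ i → t j = d j) → (d i < t i ∧ d i < s) ∨ (t i < d i ∧ s < d i)) ∧
      ((∀ j, j ≠ i → a j = d j) → (a i < d i ∧ d i < s) ∨ (d i < a i ∧ s < d i)) ∧
      a i ≠ s ∧ t i ≠ s' ∧
      ((∀ j, j ≠ i → a j = t j) → (a i < t i ∧ d i < s) ∨ (t i < a i ∧ s < d i)) := by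
  by_cases hrule : ∃ i, a i ≠ t i ∧ ¬ (∀ j, j ≠ i → t j = d j) ∧ ¬ (∀ j, j ≠ i → a j = d j)
  · obtain ⟨i, hi, hT, hA⟩ := hrule
    exact ⟨i, exists_levels_of_apply_ne hρ haQ htQ hi (fun h => absurd h hT) (fun h => absurd h hA)⟩
  have hrule' : ∀ i, a i ≠ t i → ¬ (∀ j, j ≠ i → t j = d j) → ∀ j, j ≠ i → a j = d j := by
    intro i hi hT
    by_contra hA
    exact hrule ⟨i, hi, hT, hA⟩
  obtain ⟨i₀, hi₀⟩ := Function.ne_iff.1 hat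
  -- an axis different from `i₀`
  obtain ⟨j₀, hj₀⟩ : ∃ j : Fin 3, j ≠ i₀ := ⟨i₀ + 1, by fin_cases i₀ <;> decide⟩
  by_cases hT : ∀ j, j ≠ i₀ → t j = d j
  · have hti₀ : t i₀ ≠ d i₀ := apply_ne_of_ne htd hT
    by_cases hA : ∀ j, j ≠ i₀ → a j = d j
    · -- all three on the axis line through `d`: use the other axis `j₀`
      have hai₀ : a i₀ ≠ d i₀ := apply_ne_of_ne had hA
      refine ⟨j₀, d j₀ + ρ, d j₀ - ρ, Or.inl ⟨rfl, rfl⟩, fun h => absurd (h i₀ hj₀.symm) hti₀,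
        fun h => absurd (h i₀ hj₀.symm) hai₀, ?_, ?_, fun h => absurd (h i₀ hj₀.symm) hi₀⟩
      · rw [hA j₀ hj₀]; omega
      · rw [hT j₀ hj₀]; omega
    · -- `a` leaves the line at some `j ≠ i₀`, where `a j ≠ t j = d j`
      push Not at hA
      obtain ⟨j, hj, haj⟩ := hA
      have hajt : a j ≠ t j := by rw [hT j hj]; exact haj
      have hTj : ¬ (∀ k, k ≠ j → t k = d k) := fun h => hti₀ (h i₀ hj.symm)
      have hAj : ∀ k, k ≠ j → a k = d k := hrule' j hajt hTj
      refine ⟨j, exists_levels_of_apply_ne hρ haQ htQ hajt (fun h => absurd h hTj) fun _ => ?_⟩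
      rw [← hT j hj]
      exact ⟨id, id⟩
  · have hA : ∀ j, j ≠ i₀ → a j = d j := hrule' i₀ hi₀ hT
    have hai₀ : a i₀ ≠ d i₀ := apply_ne_of_ne had hA
    push Not at hT
    obtain ⟨j, hj, htj⟩ := hT
    have hajt : a j ≠ t j := by rw [hA j hj]; exact htj.symm
    have hAj : ¬ (∀ k, k ≠ j → a k = d k) := fun h => hai₀ (h i₀ hj.symm)
    have hTj : ∀ k, k ≠ j → t k = d k := by
      by_contra h
      exact hAj (hrule' j hajt h)
    refine ⟨j, exists_levels_of_apply_ne hρ haQ htQ hajt (fun _ => ?_) (fun h => absurd h hAj)⟩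
    rw [← hA j hj]
    exact ⟨id, id⟩


end Geometry

end UnifDim

end Summit.CriticalPhenomena.PercolationContinuityZ3.Theorems
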